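import Summits.HodgeConjecture.HodgeConjecture.Theorems.Ring2AbelianAllAndreInvariantHodgeTypes
import HarnessLib

/-!
# Ring 2 · sub-cell AbelianAll (ALL ABELIAN VARIETIES), André axis, part XVI-b — rigidity of the Hodge type of
# invariant classes in a GENERAL degree `2p`: (N_p)(t₀) ⟹ `I_{2p}(t₀) ⊂ H^{p,p}` ⟺ "every off-diagonal type
# component of `H²ᵖ(𝒳)` dies on a fibre" (⟸ modulo `HC^p(𝒳)`), all independent of the fibre; and the
# `h^{2,0} = 1` span statement for a surviving (2,0)-class

HONEST FRAMING (page 1, verbatim): **research route, not a corollary; conditional on HC_CM plus one named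
minimal statement.** Cell line: research route conditional on HC_CM; not a corollary; Q11.4-sentence-2
already refuted in dim ≥ 3. Nothing in this file proves a case of the Hodge conjecture for an abelian variety.
`HC_CM` = `Theses.RankFourFaces.CMAbelianHodge` does not occur in this file; item `Theses.RankFourFaces.CMToAbelian`
(stmt-16267) OPEN and not closed here. Seat `pub-hodge-ring2-ab-andre-2`, gen 8; companion of part XVI-a
(`Ring2AbelianAllAndreInvariantHodgeTypes`: Deligne, Hodge II, Cor. 4.1.2 / (4.1.3.1) on the carriers).

## What is proved (theorems only; no definition, no named fact, no sorry)

* `typePiece_twoZero_eq_span_of_finrank_eq_one` — a class `η` of type `(2,0)` on the total space `𝒳` of a compact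
  pencil with `j_s^* η ≠ 0` SPANS the `(2,0)`-piece of `H²(𝒳_s(ℂ); ℂ)` whenever that piece is a line
  (`h^{2,0}(𝒳_s) = 1`: abelian or K3 surfaces in print) — the second branch of part XVI-a's dichotomy reads "one
  global 2-form class is THE holomorphic 2-form of every fibre" (a constant period map, in print).
* `hodgeType_pp_map_fiberι_of_algebraicInvariantClassesAt` — (N_p f)(t₀) ⟹ every class of `I_{2p}(t₀) =
  j_{t₀}^* H²ᵖ(𝒳)` is of type `(p,p)` (algebraic classes are `(p,p)`, a tree theorem).
* `hodgeType_pp_map_fiberι_iff_offDiagonal_vanish` — `I_{2p}(t₀) ⊂ H^{p,p}(𝒳_{t₀})` ⟺ `j_{t₀}^* η = 0` for every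
  class `η` of `𝒳` of a type `(p',q') ≠ (p,p)`, `p' + q' = 2p` (part XVI-a §1 in one Hodge model of `𝒳`).
* `algebraicInvariantClassesAt_iff_offDiagonal_vanish_of_hodgeClassesAlgebraic` — (N_p f)(t₀) ⟺ the off-diagonal
  vanishing, MODULO `HC^p(𝒳)` (the Hodge conjecture for the total space in codimension `p`, an explicit HYPOTHESIS;
  a theorem for `p ≤ 1`, where this is part XVI-a's three-way equivalence).
* `hodgeType_pp_map_fiberι_iff_of_fibre` — "`I_{2p}(t₀) ⊂ H^{p,p}`" does not depend on `t₀` (part XVI-a's rigidity).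

READING (RING2-MAP §AbelianAll gen 8). For the W₆ habitat ((W_E)₃ pencils, `d = 6`, `p = 3`): (N₃)(t₀) — the
smallest open instance of the axis (parts XIV-g/XV-b/XV-e) — IMPLIES that every class of `H⁶(𝒳)` of type
`(6,0), (5,1), (4,2), (2,4), (1,5), (0,6)` dies on the fibres; conversely that vanishing gives (N₃) only modulo
`HC³` of the 7-fold `𝒳`, which is not a theorem. So in degree `2p ≥ 4` the Hodge-type test is a NECESSARY
condition for (N_p), not a criterion — unlike degree 2 (part XVI-a), where Lefschetz (1,1) closes the loop.

References: DeligneHodgeII1971 (Cor. 4.1.2, (4.1.3.1)); VoisinHodgeI2002 (§6.1.3 Thm. 6.18, §7.1.1, §7.3.2,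
§11.3 Prop. 11.20, §11.3.3 Lemma 11.41); Voisin2025 (Prop. 2.11); Abdulali1994FamiliesAV (Thm. 5.5 p. 1130);
Andre1996Motifs (§5.1 (A4), p. 25).
-/

noncomputable section

set_option linter.dupNamespace false

namespace Summit.HodgeConjecture.HodgeConjecture.Ring2.AbelianAll

open CategoryTheory AlgebraicGeometry
open Literature.AlgebraicGeometry Literature.AlgebraicGeometry.Motives
open Literature.AlgebraicGeometry.HodgeTheory
open Literature.AlgebraicTopology.SingularHomology (singularCohomology)

variable {𝒳 S : SchemeOver ℂ}

/-! ## §1 A surviving (2,0)-class spans `H^{2,0}` of every fibre with `h^{2,0} = 1` -/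

/-- **A surviving (2,0)-class spans `H^{2,0}` of every fibre with `h^{2,0} = 1`** (e.g. abelian or K3 surfaces,
in print): if `η` is of type `(2,0)` on `𝒳` with `j_s^* η ≠ 0`, and the `(2,0)`-piece of `H²(𝒳_s(ℂ); ℂ)` read in
a Hodge model `B` of the fibre is a line, that line is `ℂ · j_s^* η`. [cite: VoisinHodgeI2002, §7.1.1 and §7.3.2] -/
theorem typePiece_twoZero_eq_span_of_finrank_eq_one {d : ℕ} {f : 𝒳 ⟶ S} (hf : IsCompactAbelianPencil f d)
    {η : complexBetti 𝒳 (2 * 1)} (hη : IsOfHodgeType (d + 1) 𝒳 (2 * 1) 2 0 η) {s : ComplexPoints S}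
    (hne : complexBetti.map (fiberι f s) (2 * 1) η ≠ 0) (B : HodgeModel d (fiberOver f s))
    (h20 : (2, 0) ∈ Finset.HasAntidiagonal.antidiagonal (2 * 1))
    (h1 : Module.finrank ℂ ↥(B.typePiece (2 * 1) ⟨(2, 0), h20⟩) = 1) :
    B.typePiece (2 * 1) ⟨(2, 0), h20⟩ = ℂ ∙ complexBetti.map (fiberι f s) (2 * 1) η := by
  have hXs := hf.isSmoothProjective_fiberOver s
  have hmem : complexBetti.map (fiberι f s) (2 * 1) η ∈ B.typePiece (2 * 1) ⟨(2, 0), h20⟩ :=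
    B.mem_typePiece_of_isOfHodgeType hodgePQ_independent_of_hodgeModel_holds hXs h20
      (hη.map_of_isSmoothProjective hXs hf.isSmoothProjective_total (fiberι f s))
  refine le_antisymm ?_ ((Submodule.span_singleton_le_iff_mem _ _).2 hmem)
  intro x hx
  set T := B.typePiece (2 * 1) ⟨(2, 0), h20⟩ with hT
  let v : ↥T := ⟨complexBetti.map (fiberι f s) (2 * 1) η, hmem⟩
  have hv0 : v ≠ 0 := by
    intro h
    apply hne
    have h' : (v : complexBetti (fiberOver f s) (2 * 1)) = ((0 : ↥T) : complexBetti (fiberOver f s) (2 * 1)) :=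
      congrArg Subtype.val h
    exact h'
  obtain ⟨c, hc⟩ := (finrank_eq_one_iff_of_nonzero' v hv0).1 h1 ⟨x, hx⟩
  rw [Submodule.mem_span_singleton]
  refine ⟨c, ?_⟩
  have hc' : ((c • v : ↥T) : complexBetti (fiberOver f s) (2 * 1)) =
      ((⟨x, hx⟩ : ↥T) : complexBetti (fiberOver f s) (2 * 1)) := congrArg Subtype.val hc
  exact hc'

/-! ## §2 General degree: (N_p)(t₀) and the Hodge type of `I_{2p}(t₀)` -/

/-- **(N_p f)(t₀) ⟹ `I_{2p}(t₀) ⊂ H^{p,p}`**: algebraic invariant classes are of type `(p,p)` on the fibre.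
[cite: VoisinHodgeI2002, §11.3 Prop. 11.20 and §7.3.2] -/
theorem hodgeType_pp_map_fiberι_of_algebraicInvariantClassesAt {d : ℕ} {f : 𝒳 ⟶ S}
    (hf : IsCompactAbelianPencil f d) {t₀ : ComplexPoints S} {p : ℕ} (hN : AlgebraicInvariantClassesAt hf t₀ p)
    (W : complexBetti 𝒳 (2 * p)) :
    IsOfHodgeType d (fiberOver f t₀) (2 * p) p p (complexBetti.map (fiberι f t₀) (2 * p) W) := by
  obtain ⟨D, hD, hDW⟩ := hN W
  rw [← hDW]
  exact (isOfHodgeType_of_mem_algebraicClasses_of_isSmoothProjective hf.isSmoothProjective_total p hD)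
    |>.map_of_isSmoothProjective (hf.isSmoothProjective_fiberOver t₀) hf.isSmoothProjective_total (fiberι f t₀)

/-- **`I_{2p}(t₀) ⊂ H^{p,p}` iff every OFF-DIAGONAL type piece of `H²ᵖ(𝒳)` dies on `𝒳_{t₀}`**: every class of
`j_{t₀}^* H²ᵖ(𝒳)` is of type `(p,p)` iff `j_{t₀}^* η = 0` for every class `η` of `𝒳` of some type `(p',q')`,
`p' + q' = 2p`, `(p',q') ≠ (p,p)`. [cite: VoisinHodgeI2002, Thm. 6.18 and §7.3.2] [cite: DeligneHodgeII1971, (4.1.3.1)] -/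
theorem hodgeType_pp_map_fiberι_iff_offDiagonal_vanish {d : ℕ} {f : 𝒳 ⟶ S} (hf : IsCompactAbelianPencil f d)
    (t₀ : ComplexPoints S) (p : ℕ) :
    (∀ W : complexBetti 𝒳 (2 * p),
        IsOfHodgeType d (fiberOver f t₀) (2 * p) p p (complexBetti.map (fiberι f t₀) (2 * p) W)) ↔
      ∀ (p' q' : ℕ), p' + q' = 2 * p → (p', q') ≠ (p, p) → ∀ η : complexBetti 𝒳 (2 * p),
        IsOfHodgeType (d + 1) 𝒳 (2 * p) p' q' η → complexBetti.map (fiberι f t₀) (2 * p) η = 0 := by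
  have h𝒳 := hf.isSmoothProjective_total
  have hXt := hf.isSmoothProjective_fiberOver t₀
  refine ⟨fun h p' q' _ hne η hη ↦ ?_, fun h W ↦ ?_⟩
  · exact (hη.map_of_isSmoothProjective hXt h𝒳 (fiberι f t₀)).eq_zero_of_ne hXt (h η) hne
  · obtain ⟨A⟩ := nonempty_hodgeModel_holds h𝒳
    rw [isOfHodgeType_map_iff_forall_typeProj h𝒳 hXt (fiberι f t₀) A (show p + p = 2 * p by ring)]
    rintro ⟨⟨a, b⟩, hab⟩ hne
    exact h a b (Finset.HasAntidiagonal.mem_antidiagonal.1 hab) hne _ (isOfHodgeType_typeProj A hab W)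

/-- **(N_p f)(t₀) ⟺ "the off-diagonal type pieces of `H²ᵖ(𝒳)` die on `𝒳_{t₀}`", modulo `HC^p(𝒳)`** (the Hodge
conjecture for the total space in codimension `p`, a HYPOTHESIS — a theorem for `p ≤ 1`): ⟹ unconditionally
(previous two theorems); ⟸ by part XIV-h's `algebraicInvariantClassesAt_of_hodgeType_of_hodgeClassesAlgebraic`.
[cite: VoisinHodgeI2002, §11.3.3 Lemma 11.41] [cite: Voisin2025, Prop. 2.11] [cite: DeligneHodgeII1971, (4.1.3.1)] -/
theorem algebraicInvariantClassesAt_iff_offDiagonal_vanish_of_hodgeClassesAlgebraic {d : ℕ} {f : 𝒳 ⟶ S}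
    (hf : IsCompactAbelianPencil f d) (t₀ : ComplexPoints S) (p : ℕ)
    (hHC : ∀ c : complexBetti 𝒳 (2 * p), IsRationalClass c → IsOfHodgeType (d + 1) 𝒳 (2 * p) p p c →
      c ∈ algebraicClasses 𝒳 p) :
    AlgebraicInvariantClassesAt hf t₀ p ↔
      ∀ (p' q' : ℕ), p' + q' = 2 * p → (p', q') ≠ (p, p) → ∀ η : complexBetti 𝒳 (2 * p),
        IsOfHodgeType (d + 1) 𝒳 (2 * p) p' q' η → complexBetti.map (fiberι f t₀) (2 * p) η = 0 := by
  rw [← hodgeType_pp_map_fiberι_iff_offDiagonal_vanish hf t₀ p]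
  exact ⟨fun hN W ↦ hodgeType_pp_map_fiberι_of_algebraicInvariantClassesAt hf hN W,
    fun h ↦ algebraicInvariantClassesAt_of_hodgeType_of_hodgeClassesAlgebraic hf t₀ p (fun W _ ↦ h W) hHC⟩

/-- The off-diagonal vanishing condition is independent of the fibre (flatness), so is "`I_{2p}(t₀) ⊂ H^{p,p}`".
[cite: DeligneHodgeII1971, Cor. 4.1.2 and (4.1.3.1)] [cite: Andre1996Motifs, §5.1 (p. 25)] -/
theorem hodgeType_pp_map_fiberι_iff_of_fibre {d : ℕ} {f : 𝒳 ⟶ S} (hf : IsCompactAbelianPencil f d)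
    (s t₀ : ComplexPoints S) (p : ℕ) :
    (∀ W : complexBetti 𝒳 (2 * p),
        IsOfHodgeType d (fiberOver f t₀) (2 * p) p p (complexBetti.map (fiberι f t₀) (2 * p) W)) ↔
      ∀ W : complexBetti 𝒳 (2 * p),
        IsOfHodgeType d (fiberOver f s) (2 * p) p p (complexBetti.map (fiberι f s) (2 * p) W) :=
  forall_congr' fun W ↦ isOfHodgeType_map_fiberι_iff hf W s t₀
end Summit.HodgeConjecture.HodgeConjecture.Ring2.AbelianAll

end
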